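import Summits.AtomisticToContinuum.FouriersLaw.Theorems.OddSectorIrreversibilityCorrectorTheoryDetFlow
import Mathlib.Analysis.ODE.Gronwall

/-!
# `TapLeakBound` (stmt-AtomisticToContinuum-15159), line `SketchIdeator2`: block light cone for the closed chain — preliminaries

Helper file (`--supports stmt-AtomisticToContinuum-15159`) for crux
P = `Summit.AtomisticToContinuum.FouriersLaw.Theses.OddSectorIrreversibility.TapLeakBound`, registered stub `stub_kickCone`
(C′ `ResampledKickCone`: the resampled-kick influence of the contact momentum on `j_i ∘ Φ_s` should decay inside a window;
its open content is an `N`-uniform propagation estimate for the CLOSED pinned FPU-β chain). This file and its companion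
`…TapLeakBoundBlockCone.lean` land the deterministic, `N`-uniform core of every energy-truncation ("cold cone") argument:
a Lieb–Robinson-type bound for two trajectories of `detFlow` whose positions stay in a box on a BLOCK of sites. Here:

* `gronwall_affine` — scalar Grönwall in integral form with an affine source: `f ≤ A + Bt + K∫₀ᵗ f ⇒ f(t) ≤ (A + Bt)e^{Kt}`;
* `abs_dU_sub_dU_le`, `abs_dV_sub_dV_le` — Lipschitz bounds of the forces `U' = ω₂q + lam q³`, `V' = r + βr³` on boxes;
* `detFlow_fst_apply_eq`, `detFlow_snd_apply_eq` — the per-site integral equations `q_k(t) = q_k(0) + ∫₀ᵗ p_k`,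
  `p_k(t) = p_k(0) - ∫₀ᵗ ∂_{q_k}Φ(q)` of the closed flow, and the discrepancy inequalities `abs_sub_fst_le`, `abs_sub_snd_le`
  for two trajectories;
* `abs_dPotential_sub_le` — the force difference at site `k` is `Λ²`-Lipschitz in the discrepancies at `k-1, k, k+1` when
  these positions are boxed (`Λ² ≥ |ω₂| + 3 lam R²`, `Λ² ≥ 1 + 12 β R²`).

References: Lieb–Robinson-type bounds for classical lattices (Marchioro–Pellegrinotti–Pulvirenti–Triolo 1978;
Buttà–Caglioti–Di Ruzza–Marchioro 2007 §3; Raz–Sims 2009 §4), in elementary finite-block form; folklore.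
Nothing here closes the item.
-/

noncomputable section

open MeasureTheory Filter Topology Set Function Metric
open scoped NNReal

namespace Summit.AtomisticToContinuum.FouriersLaw.Theorems.OddSectorIrreversibility.TapLeak

open Literature.MathematicalPhysics.KineticTheory.HeatConduction
open Literature.MathematicalPhysics.KineticTheory

/-! ### §1 Scalar Grönwall with an affine source -/

/-- **Grönwall, integral form, affine source.** If `f` is continuous, nonnegative, and
`f(t) ≤ A + B t + K ∫₀ᵗ f` on `[0, s]` with `A, B, K ≥ 0`, then `f(t) ≤ (A + B t) e^{K t}` on `[0, s]`. [folklore] -/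
theorem gronwall_affine {f : ℝ → ℝ} {s A B K : ℝ} (hA : 0 ≤ A) (hB : 0 ≤ B) (hK : 0 ≤ K)
    (hf : Continuous f) (hf0 : ∀ t ∈ Icc 0 s, 0 ≤ f t)
    (h : ∀ t ∈ Icc 0 s, f t ≤ A + B * t + K * ∫ τ in (0 : ℝ)..t, f τ) :
    ∀ t ∈ Icc 0 s, f t ≤ (A + B * t) * Real.exp (K * t) := by
  intro t ht
  -- the comparison function `F(t) = A + Bt + K ∫₀ᵗ f`
  set F : ℝ → ℝ := fun u => A + B * u + K * ∫ τ in (0 : ℝ)..u, f τ with hF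
  have hFderiv : ∀ u, HasDerivAt F (B + K * f u) u := by
    intro u
    have h1 : HasDerivAt (fun u => ∫ τ in (0 : ℝ)..u, f τ) (f u) u :=
      intervalIntegral.integral_hasDerivAt_right (hf.intervalIntegrable _ _)
        hf.aestronglyMeasurable.stronglyMeasurableAtFilter hf.continuousAt
    have h2 : HasDerivAt (fun u => A + B * u) B u := by
      simpa using ((hasDerivAt_id u).const_mul B).const_add A
    have h3 := h2.add (h1.const_mul K)
    show HasDerivAt (fun u => A + B * u + K * ∫ τ in (0 : ℝ)..u, f τ) (B + K * f u) u
    exact h3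
  have hFcont : Continuous F := by
    have : Differentiable ℝ F := fun u => (hFderiv u).differentiableAt
    exact this.continuous
  -- `F' ≤ K F + B` on `[0, s)` (uses `f ≤ F` and `K ≥ 0`), and `F ≥ 0` there
  have hfF : ∀ u ∈ Icc 0 s, f u ≤ F u := fun u hu => h u hu
  have hF0 : ∀ u ∈ Icc 0 s, 0 ≤ F u := fun u hu => (hf0 u hu).trans (hfF u hu)
  have hbound : ∀ u ∈ Ico 0 s, ‖B + K * f u‖ ≤ K * ‖F u‖ + B := by
    intro u hu
    have hu' : u ∈ Icc 0 s := Ico_subset_Icc_self hu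
    rw [Real.norm_of_nonneg (by nlinarith [hf0 u hu', hK, hB]), Real.norm_of_nonneg (hF0 u hu')]
    nlinarith [hfF u hu', hK]
  have hFa : ‖F 0‖ ≤ A := by
    simp [hF, Real.norm_of_nonneg hA]
  have hG := norm_le_gronwallBound_of_norm_deriv_right_le (f := F) (f' := fun u => B + K * f u)
    (a := 0) (b := s) hFcont.continuousOn (fun u _ => (hFderiv u).hasDerivWithinAt) hFa hbound t ht
  rw [sub_zero] at hG
  have hFt : F t ≤ gronwallBound A K B t := by
    have h' := hG
    rwa [Real.norm_of_nonneg (hF0 t ht)] at h'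
  -- `gronwallBound A K B t ≤ (A + Bt) e^{Kt}`
  have hgb : gronwallBound A K B t ≤ (A + B * t) * Real.exp (K * t) := by
    rcases eq_or_lt_of_le hK with hK0 | hKpos
    · rw [← hK0, gronwallBound_K0, zero_mul, Real.exp_zero, mul_one]
    · have hgb' : gronwallBound A K B t = A * Real.exp (K * t) + B / K * (Real.exp (K * t) - 1) := by
        rw [gronwallBound_of_K_ne_0 hKpos.ne']
      rw [hgb']
      have ht0 : 0 ≤ t := ht.1
      -- `(e^{Kt} - 1)/K ≤ t e^{Kt}`
      have hexp : Real.exp (K * t) - 1 ≤ K * t * Real.exp (K * t) := by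
        have h1 : Real.exp (K * t) - 1 ≤ K * t * Real.exp (K * t) := by
          have := Real.add_one_le_exp (-(K * t))
          have hpos := Real.exp_pos (K * t)
          have hmul : Real.exp (-(K * t)) * Real.exp (K * t) = 1 := by
            rw [← Real.exp_add]; simp
          nlinarith [mul_le_mul_of_nonneg_right this hpos.le]
        exact h1
      have : B / K * (Real.exp (K * t) - 1) ≤ B * t * Real.exp (K * t) := by
        rw [div_mul_eq_mul_div, div_le_iff₀ hKpos]
        nlinarith [mul_le_mul_of_nonneg_left hexp hB]
      nlinarith
  exact hfF t ht |>.trans (hFt.trans hgb)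

/-! ### §2 Lipschitz bounds of the forces on position boxes -/

/-- `|U'(a) - U'(a')| ≤ (ω₂ + 3 lam R²)|a - a'|` for `|a|, |a'| ≤ R` (`U' = ω₂ q + lam q³`, `lam ≥ 0`). [folklore] -/
theorem abs_dU_sub_dU_le {ω₂ lam R a a' : ℝ} (hl : 0 ≤ lam) (ha : |a| ≤ R) (ha' : |a'| ≤ R) :
    |(ω₂ * a + lam * a ^ 3) - (ω₂ * a' + lam * a' ^ 3)| ≤ (|ω₂| + 3 * lam * R ^ 2) * |a - a'| := by
  have hid : (ω₂ * a + lam * a ^ 3) - (ω₂ * a' + lam * a' ^ 3) =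
      (a - a') * (ω₂ + lam * (a ^ 2 + a * a' + a' ^ 2)) := by ring
  rw [hid, abs_mul, mul_comm]
  refine mul_le_mul_of_nonneg_right ?_ (abs_nonneg _)
  have hR : 0 ≤ R := (abs_nonneg a).trans ha
  have h2 : |a ^ 2 + a * a' + a' ^ 2| ≤ 3 * R ^ 2 := by
    have haa : |a| * |a| ≤ R * R := mul_le_mul ha ha (abs_nonneg _) hR
    have haa' : |a| * |a'| ≤ R * R := mul_le_mul ha ha' (abs_nonneg _) hR
    have ha'a' : |a'| * |a'| ≤ R * R := mul_le_mul ha' ha' (abs_nonneg _) hR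
    calc |a ^ 2 + a * a' + a' ^ 2| ≤ |a ^ 2| + |a * a'| + |a' ^ 2| := abs_add_three _ _ _
      _ = |a| * |a| + |a| * |a'| + |a'| * |a'| := by
          rw [abs_mul, pow_two, pow_two, abs_mul, abs_mul]
      _ ≤ 3 * R ^ 2 := by nlinarith
  calc |ω₂ + lam * (a ^ 2 + a * a' + a' ^ 2)| ≤ |ω₂| + |lam * (a ^ 2 + a * a' + a' ^ 2)| := abs_add_le _ _
    _ = |ω₂| + lam * |a ^ 2 + a * a' + a' ^ 2| := by rw [abs_mul, abs_of_nonneg hl]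
    _ ≤ |ω₂| + lam * (3 * R ^ 2) := by gcongr
    _ = |ω₂| + 3 * lam * R ^ 2 := by ring

/-- `|V'(r) - V'(r')| ≤ (1 + 3 β ρ²)|r - r'|` for `|r|, |r'| ≤ ρ` (`V' = r + β r³`, `β ≥ 0`). [folklore] -/
theorem abs_dV_sub_dV_le {β ρ r r' : ℝ} (hβ : 0 ≤ β) (hr : |r| ≤ ρ) (hr' : |r'| ≤ ρ) :
    |(r + β * r ^ 3) - (r' + β * r' ^ 3)| ≤ (1 + 3 * β * ρ ^ 2) * |r - r'| := by
  have h := abs_dU_sub_dU_le (ω₂ := 1) hβ hr hr'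
  simpa only [one_mul, abs_one] using h


/-! ### §3 Component integral equations of the closed flow and discrepancy inequalities -/

section Flow

open Summit.AtomisticToContinuum.FouriersLaw.Theorems.ClosedConeSensitivity.Negative.ZeroFrictionDictionary
open Summit.AtomisticToContinuum.FouriersLaw.Theorems.OddSectorIrreversibility.Corrector
open Summit.AtomisticToContinuum.FouriersLaw.Theorems.SuperadditiveResistance.DeviceLiouville

variable {ω₂ lam β : ℝ} (hω : 0 < ω₂) (hl : 0 ≤ lam) (hβ : 0 ≤ β)
include hω hl hβ

/-- Continuity in time of a position coordinate of the closed flow. [folklore] -/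
theorem continuous_detFlow_fst_apply (N : ℕ) (x : PhaseSpace N) (k : Fin N) :
    Continuous fun t => (detFlow ω₂ lam β N t x).1 k :=
  (continuous_apply k).comp (continuous_fst.comp (continuous_detFlow_time hω hl hβ N x))

/-- Continuity in time of a momentum coordinate of the closed flow. [folklore] -/
theorem continuous_detFlow_snd_apply (N : ℕ) (x : PhaseSpace N) (k : Fin N) :
    Continuous fun t => (detFlow ω₂ lam β N t x).2 k :=
  (continuous_apply k).comp (continuous_snd.comp (continuous_detFlow_time hω hl hβ N x))

/-- **Position component of the integral equation**: `q_k(t) = q_k(0) + ∫₀ᵗ p_k` (`t ≥ 0`). [folklore] -/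
theorem detFlow_fst_apply_eq (N : ℕ) (x : PhaseSpace N) (k : Fin N) {t : ℝ} (ht : 0 ≤ t) :
    (detFlow ω₂ lam β N t x).1 k = x.1 k + ∫ τ in (0 : ℝ)..t, (detFlow ω₂ lam β N τ x).2 k := by
  have h := detFlow_eq_add_integral hω hl hβ N x ht
  set Y := (pinnedChain ω₂ lam β 0).drift N with hY
  have hYc : Continuous Y := (pinnedChain_contDiff_drift ω₂ lam β 0 N (n := 0)).continuous
  have hc : Continuous fun τ => Y (detFlow ω₂ lam β N τ x) := hYc.comp (continuous_detFlow_time hω hl hβ N x)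
  -- project with the continuous linear map `z ↦ z.1 k`
  set Lk : PhaseSpace N →L[ℝ] ℝ := (ContinuousLinearMap.proj k).comp (ContinuousLinearMap.fst ℝ _ _) with hLk
  have hproj : ∀ z : PhaseSpace N, Lk z = z.1 k := fun z => rfl
  have h1 : Lk (detFlow ω₂ lam β N t x) = Lk (x + ∫ τ in (0 : ℝ)..t, Y (detFlow ω₂ lam β N τ x)) := by rw [← h]
  rw [map_add, ← Lk.intervalIntegral_comp_comm (hc.intervalIntegrable _ _)] at h1
  simp only [hproj] at h1
  rw [h1]
  congr 1

/-- **Momentum component of the integral equation**: `p_k(t) = p_k(0) - ∫₀ᵗ ∂_{q_k}Φ(q(τ)) dτ` (`t ≥ 0`). [folklore] -/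
theorem detFlow_snd_apply_eq (N : ℕ) (x : PhaseSpace N) (k : Fin N) {t : ℝ} (ht : 0 ≤ t) :
    (detFlow ω₂ lam β N t x).2 k = x.2 k +
      ∫ τ in (0 : ℝ)..t, -(pinnedChain ω₂ lam β 0).dPotential N k (detFlow ω₂ lam β N τ x).1 := by
  have h := detFlow_eq_add_integral hω hl hβ N x ht
  set Y := (pinnedChain ω₂ lam β 0).drift N with hY
  have hYc : Continuous Y := (pinnedChain_contDiff_drift ω₂ lam β 0 N (n := 0)).continuous
  have hc : Continuous fun τ => Y (detFlow ω₂ lam β N τ x) := hYc.comp (continuous_detFlow_time hω hl hβ N x)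
  set Lk : PhaseSpace N →L[ℝ] ℝ := (ContinuousLinearMap.proj k).comp (ContinuousLinearMap.snd ℝ _ _) with hLk
  have hproj : ∀ z : PhaseSpace N, Lk z = z.2 k := fun z => rfl
  have h1 : Lk (detFlow ω₂ lam β N t x) = Lk (x + ∫ τ in (0 : ℝ)..t, Y (detFlow ω₂ lam β N τ x)) := by rw [← h]
  rw [map_add, ← Lk.intervalIntegral_comp_comm (hc.intervalIntegrable _ _)] at h1
  simp only [hproj] at h1
  rw [h1]
  congr 1
  refine intervalIntegral.integral_congr fun τ _ => ?_
  rw [hY, drift_zero_friction]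
  rfl

/-- Continuity in time of the force component `∂_{q_k}Φ` along the closed flow. [folklore] -/
theorem continuous_dPotential_detFlow (N : ℕ) (x : PhaseSpace N) (k : Fin N) :
    Continuous fun τ => (pinnedChain ω₂ lam β 0).dPotential N k (detFlow ω₂ lam β N τ x).1 := by
  have hc := ((pinnedChain ω₂ lam β 0).contDiff_dPotential (pinnedChain_contDiff_U ω₂ lam β 0)
    (pinnedChain_contDiff_V ω₂ lam β 0) N k).continuous
  exact hc.comp (continuous_fst.comp (continuous_detFlow_time hω hl hβ N x))

/-- **Discrepancy of positions**: `|δq_k(t)| ≤ |δq_k(0)| + ∫₀ᵗ |δp_k|` for two trajectories of the closed flow. [folklore] -/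
theorem abs_sub_fst_le (N : ℕ) (x y : PhaseSpace N) (k : Fin N) {t : ℝ} (ht : 0 ≤ t) :
    |(detFlow ω₂ lam β N t x).1 k - (detFlow ω₂ lam β N t y).1 k| ≤ |x.1 k - y.1 k| +
      ∫ τ in (0 : ℝ)..t, |(detFlow ω₂ lam β N τ x).2 k - (detFlow ω₂ lam β N τ y).2 k| := by
  have hx := detFlow_fst_apply_eq hω hl hβ N x k ht
  have hy := detFlow_fst_apply_eq hω hl hβ N y k ht
  have hix := (continuous_detFlow_snd_apply hω hl hβ N x k).intervalIntegrable (μ := volume) 0 t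
  have hiy := (continuous_detFlow_snd_apply hω hl hβ N y k).intervalIntegrable (μ := volume) 0 t
  have hsub : (detFlow ω₂ lam β N t x).1 k - (detFlow ω₂ lam β N t y).1 k = (x.1 k - y.1 k) +
      ∫ τ in (0 : ℝ)..t, ((detFlow ω₂ lam β N τ x).2 k - (detFlow ω₂ lam β N τ y).2 k) := by
    rw [hx, hy, intervalIntegral.integral_sub hix hiy]; ring
  rw [hsub]
  refine (abs_add_le _ _).trans ?_
  gcongr
  exact intervalIntegral.abs_integral_le_integral_abs ht

/-- **Discrepancy of momenta**: `|δp_k(t)| ≤ |δp_k(0)| + ∫₀ᵗ |∂_{q_k}Φ(q) - ∂_{q_k}Φ(q')|`. [folklore] -/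
theorem abs_sub_snd_le (N : ℕ) (x y : PhaseSpace N) (k : Fin N) {t : ℝ} (ht : 0 ≤ t) :
    |(detFlow ω₂ lam β N t x).2 k - (detFlow ω₂ lam β N t y).2 k| ≤ |x.2 k - y.2 k| +
      ∫ τ in (0 : ℝ)..t, |(pinnedChain ω₂ lam β 0).dPotential N k (detFlow ω₂ lam β N τ x).1 -
        (pinnedChain ω₂ lam β 0).dPotential N k (detFlow ω₂ lam β N τ y).1| := by
  have hx := detFlow_snd_apply_eq hω hl hβ N x k ht
  have hy := detFlow_snd_apply_eq hω hl hβ N y k ht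
  have hix : IntervalIntegrable (fun τ => -(pinnedChain ω₂ lam β 0).dPotential N k (detFlow ω₂ lam β N τ x).1)
      volume 0 t := ((continuous_dPotential_detFlow hω hl hβ N x k).neg).intervalIntegrable (μ := volume) 0 t
  have hiy : IntervalIntegrable (fun τ => -(pinnedChain ω₂ lam β 0).dPotential N k (detFlow ω₂ lam β N τ y).1)
      volume 0 t := ((continuous_dPotential_detFlow hω hl hβ N y k).neg).intervalIntegrable (μ := volume) 0 t
  have hsub : (detFlow ω₂ lam β N t x).2 k - (detFlow ω₂ lam β N t y).2 k = (x.2 k - y.2 k) +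
      ∫ τ in (0 : ℝ)..t, (-(pinnedChain ω₂ lam β 0).dPotential N k (detFlow ω₂ lam β N τ x).1 -
        -(pinnedChain ω₂ lam β 0).dPotential N k (detFlow ω₂ lam β N τ y).1) := by
    rw [hx, hy, intervalIntegral.integral_sub hix hiy]; ring
  rw [hsub]
  refine (abs_add_le _ _).trans ?_
  gcongr
  refine (intervalIntegral.abs_integral_le_integral_abs ht).trans (le_of_eq ?_)
  refine intervalIntegral.integral_congr fun τ _ => ?_
  simp only [neg_sub_neg, abs_sub_comm]

end Flow


/-! ### §4 The force difference on a position box -/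

/-- **Lipschitz bound of the force component on a position box.** For the pinned chain (`lam, β ≥ 0`) and two
position configurations whose coordinates at the sites `k-1, k, k+1` (those that exist) are bounded by `R`, with
`Λ₂ ≥ |ω₂| + 3 lam R²` and `Λ₂ ≥ 1 + 12 β R²`:
`|∂_kΦ(q) - ∂_kΦ(q')| ≤ Λ₂|δq_k| + [0<k] Λ₂(|δq_k| + |δq_{k-1}|) + [k+1<N] Λ₂(|δq_{k+1}| + |δq_k|)`. [folklore] -/
theorem abs_dPotential_sub_le {ω₂ lam β : ℝ} (hl : 0 ≤ lam) (hβ : 0 ≤ β) {N : ℕ} {R Λ₂ : ℝ}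
    (hΛU : |ω₂| + 3 * lam * R ^ 2 ≤ Λ₂) (hΛV : 1 + 12 * β * R ^ 2 ≤ Λ₂) (q q' : Fin N → ℝ) (k : Fin N)
    (hk : |q k| ≤ R ∧ |q' k| ≤ R)
    (hkm : ∀ h : 0 < k.val, |q ⟨k.val - 1, by omega⟩| ≤ R ∧ |q' ⟨k.val - 1, by omega⟩| ≤ R)
    (hkp : ∀ h : k.val + 1 < N, |q ⟨k.val + 1, h⟩| ≤ R ∧ |q' ⟨k.val + 1, h⟩| ≤ R) :
    |(pinnedChain ω₂ lam β 0).dPotential N k q - (pinnedChain ω₂ lam β 0).dPotential N k q'| ≤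
      Λ₂ * |q k - q' k| +
        (if h : 0 < k.val then Λ₂ * (|q k - q' k| + |q ⟨k.val - 1, by omega⟩ - q' ⟨k.val - 1, by omega⟩|) else 0) +
        (if h : k.val + 1 < N then Λ₂ * (|q ⟨k.val + 1, h⟩ - q' ⟨k.val + 1, h⟩| + |q k - q' k|) else 0) := by
  set P := pinnedChain ω₂ lam β 0 with hP
  have hR : 0 ≤ R := (abs_nonneg _).trans hk.1
  have hΛ₂0 : 0 ≤ Λ₂ := le_trans (by positivity) hΛV
  have hU' : ∀ a, deriv P.U a = ω₂ * a + lam * a ^ 3 := fun a => pinnedChain_deriv_U ω₂ lam β 0 a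
  have hV' : ∀ r, deriv P.V r = r + β * r ^ 3 := fun r => pinnedChain_deriv_V ω₂ lam β 0 r
  -- the three pieces
  have hUpiece : |deriv P.U (q k) - deriv P.U (q' k)| ≤ Λ₂ * |q k - q' k| := by
    rw [hU', hU']
    refine (abs_dU_sub_dU_le hl hk.1 hk.2).trans ?_
    exact mul_le_mul_of_nonneg_right hΛU (abs_nonneg _)
  have hVlip : ∀ a a' b b' : ℝ, |a| ≤ R → |a'| ≤ R → |b| ≤ R → |b'| ≤ R →
      |deriv P.V (a - b) - deriv P.V (a' - b')| ≤ Λ₂ * (|a - a'| + |b - b'|) := by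
    intro a a' b b' ha ha' hb hb'
    rw [hV', hV']
    have hr : |a - b| ≤ 2 * R := (abs_sub _ _).trans (by linarith)
    have hr' : |a' - b'| ≤ 2 * R := (abs_sub _ _).trans (by linarith)
    refine (abs_dV_sub_dV_le hβ hr hr').trans ?_
    have h1 : 1 + 3 * β * (2 * R) ^ 2 = 1 + 12 * β * R ^ 2 := by ring
    rw [h1]
    have h2 : |a - b - (a' - b')| ≤ |a - a'| + |b - b'| := by
      have : a - b - (a' - b') = (a - a') - (b - b') := by ring
      rw [this]; exact abs_sub _ _
    calc (1 + 12 * β * R ^ 2) * |a - b - (a' - b')| ≤ Λ₂ * |a - b - (a' - b')| :=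
          mul_le_mul_of_nonneg_right hΛV (abs_nonneg _)
      _ ≤ Λ₂ * (|a - a'| + |b - b'|) := mul_le_mul_of_nonneg_left h2 hΛ₂0
  -- left bond piece
  have hA : |(if h : 0 < k.val then deriv P.V (q k - q ⟨k.val - 1, by omega⟩) else 0) -
      (if h : 0 < k.val then deriv P.V (q' k - q' ⟨k.val - 1, by omega⟩) else 0)| ≤
      (if h : 0 < k.val then Λ₂ * (|q k - q' k| + |q ⟨k.val - 1, by omega⟩ - q' ⟨k.val - 1, by omega⟩|) else 0) := by
    by_cases h : 0 < k.val
    · rw [dif_pos h, dif_pos h, dif_pos h]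
      exact hVlip _ _ _ _ hk.1 hk.2 (hkm h).1 (hkm h).2
    · simp [h]
  -- right bond piece
  have hB : |(if h : k.val + 1 < N then deriv P.V (q ⟨k.val + 1, h⟩ - q k) else 0) -
      (if h : k.val + 1 < N then deriv P.V (q' ⟨k.val + 1, h⟩ - q' k) else 0)| ≤
      (if h : k.val + 1 < N then Λ₂ * (|q ⟨k.val + 1, h⟩ - q' ⟨k.val + 1, h⟩| + |q k - q' k|) else 0) := by
    by_cases h : k.val + 1 < N
    · rw [dif_pos h, dif_pos h, dif_pos h]
      exact hVlip _ _ _ _ (hkp h).1 (hkp h).2 hk.1 hk.2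
    · simp [h]
  rw [P.dPotential_eq_closed N k q, P.dPotential_eq_closed N k q']
  have hsplit : ∀ u a b u' a' b' : ℝ, |(u + a - b) - (u' + a' - b')| ≤ |u - u'| + |a - a'| + |b - b'| := by
    intro u a b u' a' b'
    have : (u + a - b) - (u' + a' - b') = (u - u') + (a - a') - (b - b') := by ring
    rw [this]
    exact (abs_sub _ _).trans (by linarith [abs_add_le (u - u') (a - a')])
  refine (hsplit _ _ _ _ _ _).trans ?_
  linarith [hUpiece, hA, hB]



/-! ### Registered sub-goal of the line (closed form of `abs_dPotential_sub_le`) -/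

/-- **Sub-goal `stub_forceLipschitzBox`** (registered on the crux item for this helper file; closed `∀`-form of
`abs_dPotential_sub_le`): the force component of the closed pinned chain is Lipschitz in the three neighbouring position
discrepancies on a position box. [folklore] -/
theorem stub_forceLipschitzBox : ∀ (ω₂ lam β : ℝ), 0 ≤ lam → 0 ≤ β → ∀ (N : ℕ) (R Λ₂ : ℝ), |ω₂| + 3 * lam * R ^ 2 ≤ Λ₂ → 1 + 12 * β * R ^ 2 ≤ Λ₂ → ∀ (q q' : Fin N → ℝ) (k : Fin N), (|q k| ≤ R ∧ |q' k| ≤ R) → (∀ h : 0 < k.val, |q ⟨k.val - 1, by omega⟩| ≤ R ∧ |q' ⟨k.val - 1, by omega⟩| ≤ R) → (∀ h : k.val + 1 < N, |q ⟨k.val + 1, h⟩| ≤ R ∧ |q' ⟨k.val + 1, h⟩| ≤ R) → |(pinnedChain ω₂ lam β 0).dPotential N k q - (pinnedChain ω₂ lam β 0).dPotential N k q'| ≤ Λ₂ * |q k - q' k| + (if h : 0 < k.val then Λ₂ * (|q k - q' k| + |q ⟨k.val - 1, by omega⟩ - q' ⟨k.val - 1, by omega⟩|) else 0) + (if h : k.val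 + 1 < N then Λ₂ * (|q ⟨k.val + 1, h⟩ - q' ⟨k.val + 1, h⟩| + |q k - q' k|) else 0) :=
  fun _ _ _ hl hβ _ _ _ hΛU hΛV q q' k hk hkm hkp => abs_dPotential_sub_le hl hβ hΛU hΛV q q' k hk hkm hkp

end Summit.AtomisticToContinuum.FouriersLaw.Theorems.OddSectorIrreversibility.TapLeak

end
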